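import Summits.AnomalousDissipation.AnomalousDissipation.Theorems.DopplerClockQuadratureStressFloorKinematicExtraction
import Literature.Analysis.FunctionSpaces.TorusLinearisedFormTruncation
import Literature.Analysis.FunctionSpaces.TorusClassicalNSGluing
import Mathlib.Analysis.ODE.Gronwall

/-!
# Stub `stub_energyStabilityThreshold` of the line `Sketch` (laminar-burst-shadowing)
# (crux stmt-AnomalousDissipation-18129, `DopplerClock.QuadratureStressFloor`)

THE ENERGY-STABILITY THRESHOLD (Serrin's energy method for the laminar streak array). Let
`u_L = V e₂ + aΨ_c + bΨ_s` be the laminar streak array of the swept Doppler pair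
`f = F sin(2πm x₁) cos(2πn x₂) e₀` (`Ψ_c = sin(2πm x₁) cos(2πn x₂) e₀`,
`Ψ_s = sin(2πm x₁) sin(2πn x₂) e₀`, `a = Fνκ²/D`, `b = FV(2πn)/D`, `D = V²(2πn)² + ν²κ⁴`,
`κ² = (2π)²(m²+n²)`; item `LaminarStreaks`, `dopplerClock_laminarStreaks_proof`). For every design
`(F, V, m, n)` there are `ν_E, c > 0` such that for `ν ≥ ν_E` and every classical solution `(u, p)`
of `NS_ν(f)` on a convex time set `S ⊇ [t₀, t]` with momentum `∫ u(t₀) = V e₂`, the perturbation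
energy `E'(s) = ½‖u(s) − u_L‖₂²` decays exponentially: `E'(t) ≤ E'(t₀) e^{−c(t−t₀)}`.

**Proof.** (1) Serrin's identity (`stub_perturbationEnergyBalance` with `U = u_L`, `q = 0`):
`d/ds E' = −ν‖∇w'‖₂² − ∫⟪w', (w'·∇)u_L⟫` within `S`, `w' = u − u_L`.
(2) Transport: `(w'·∇)u_L = a(w'·∇)Ψ_c + b(w'·∇)Ψ_s` and `|∫⟪w',(w'·∇)Ψ⟫| ≤ 2π(m+n)∫‖w'‖²` for
both patterns (`PatternTransport.abs_integral_inner_self_convect_le`), so the transport term is at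
most `(|a|+|b|)·2π(m+n)·∫‖w'‖²`. (3) Momentum conservation (`integral_velocity_eq`, the force has
zero mean, `dopplerClock_forceAdmissible_proof`) and `∫ u_L = V e₂` make `w'(s)` mean-zero on `S`,
so Poincaré (`four_pi_sq_mul_integral_norm_sq_le_gradNormSq`) gives `4π²∫‖w'‖² ≤ ‖∇w'‖₂²`.
(4) For `ν ≥ ν_E ≥ 1`: `|a| ≤ F/κ²`, `|b| ≤ FV(2πn)/κ⁴` (`D ≥ ν²κ⁴ ≥ κ⁴`), and `ν_E` is chosen
with `4π²ν_E = 4π² + 2π(m+n)(F/κ² + FV(2πn)/κ⁴)`, whence `d/ds E' ≤ −4π² E'`. (5) Grönwall on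
`[t₀, t]` (Mathlib `le_gronwallBound_of_liminf_deriv_right_le` with `K = −c`, `ε = 0`, exactly as
in `Torus.IsClassicalNSSolutionOn.integral_norm_sub_sq_le_mul_exp`).

The analytic core is proved for an abstract steady state `U = c + aΦ + bΨ` with abstract pattern
bounds `∑ᵢ‖∂ᵢΦ‖, ∑ᵢ‖∂ᵢΨ‖ ≤ K` (`EnergyStabilityThreshold.flux_le`,
`EnergyStabilityThreshold.decay`); the registered statement is the instance `c = V e₂`,
`Φ = Ψ_c`, `Ψ = Ψ_s`, `K = 2π(m+n)`, with the coefficient bound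
`EnergyStabilityThreshold.coeff_bound`.

References: J. Serrin, Arch. Rational Mech. Anal. 3 (1959), §2 (the energy-stability method);
C. Marchioro, Comm. Math. Phys. 105 (1986) (the gravest-mode analogue); Doering–Gibbon 1995,
Ch. 2. No new definitions; no named facts.
-/

noncomputable section

-- `Summit.<Summit>.<Problem>` is the tree's mandated summit-side namespace (CONVENTIONS §2); for
-- this single-conjunct summit the two coincide, so the duplicate is deliberate.
set_option linter.dupNamespace false

open MeasureTheory Set Filter Topology UnitAddTorus
open scoped InnerProductSpace RealInnerProductSpace

namespace Summit.AnomalousDissipation.AnomalousDissipation.Theorems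

open Literature.Analysis.FluidPDE Literature.Analysis.FluidPDE.Torus
open Literature.Analysis.FunctionSpaces Literature.Analysis.FunctionSpaces.Torus

namespace EnergyStabilityThreshold

variable {ν K a b c₀ : ℝ} {c : EuclideanSpace ℝ (Fin 3)}
  {Φ Ψ U f : UnitAddTorus (Fin 3) → EuclideanSpace ℝ (Fin 3)} {q : UnitAddTorus (Fin 3) → ℝ}
  {S : Set ℝ} {u : ℝ → UnitAddTorus (Fin 3) → EuclideanSpace ℝ (Fin 3)}
  {p : ℝ → UnitAddTorus (Fin 3) → ℝ}

/-- **Serrin's flux is coercive above the threshold.** Let `(U, q)` be a steady classical solution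
of `NS_ν(f)` of the form `U = c + aΦ + bΨ` (`c` a constant drift, `Φ`, `Ψ` smooth patterns with
`∑ᵢ‖∂ᵢΦ‖, ∑ᵢ‖∂ᵢΨ‖ ≤ K` pointwise) and `(u, p)` a classical solution of the same system on `S`.
If at `t ∈ S` the perturbation `w' = u(t) − U` has zero mean and
`2(|a|+|b|)K + c₀ ≤ 8π²ν`, then
`−ν‖∇w'‖₂² − ∫⟪w',(w'·∇)U⟫ ≤ −c₀ · ½‖w'‖₂²`:
`(w'·∇)U = a(w'·∇)Φ + b(w'·∇)Ψ`, `|∫⟪w',(w'·∇)Φ⟫|, |∫⟪w',(w'·∇)Ψ⟫| ≤ K∫‖w'‖²`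
(Majda–Bertozzi 2002, Prop. 3.1) and Poincaré `4π²∫‖w'‖² ≤ ‖∇w'‖₂²` (Serrin 1959, §2). [folklore] -/
theorem flux_le (hν : 0 ≤ ν) (hΦ : IsSmooth Φ) (hΨ : IsSmooth Ψ)
    (hKΦ : ∀ x, ∑ i, ‖partialDeriv i Φ x‖ ≤ K) (hKΨ : ∀ x, ∑ i, ‖partialDeriv i Ψ x‖ ≤ K)
    (hUeq : ∀ x, U x = c + (a • Φ x + b • Ψ x))
    (hU : IsClassicalNSSolutionOn univ ν (fun _ => f) (fun _ => U) (fun _ => q))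
    (hu : IsClassicalNSSolutionOn S ν (fun _ => f) u p) {t : ℝ} (ht : t ∈ S)
    (h0 : HasZeroMean (fun x => u t x - U x))
    (hrate : 2 * ((|a| + |b|) * K) + c₀ ≤ 8 * Real.pi ^ 2 * ν) :
    -(ν * gradNormSq (fun x => u t x - U x)) -
        ∫ x, ⟪u t x - U x, convect (fun y => u t y - U y) U x⟫ ≤
      -c₀ * kineticEnergy (fun x => u t x - U x) := by
  -- the perturbation `w' = u(t) − U` is smooth
  have hut : IsSmooth (u t) := hu.smooth_velocity.isSmooth_slice ht
  have hUs : IsSmooth U := hU.smooth_velocity.isSmooth_slice (mem_univ t)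
  have hw : IsSmooth (fun x => u t x - U x) := hut.sub hUs
  have hΦ1 : IsContDiff 1 Φ := hΦ.isContDiff (by simp)
  have hΨ1 : IsContDiff 1 Ψ := hΨ.isContDiff (by simp)
  -- `(w'·∇)U = a (w'·∇)Φ + b (w'·∇)Ψ`
  have hUfun : U = (fun _ => c) + (a • Φ + b • Ψ) := funext fun x => by simp [hUeq x]
  have hfd : ∀ (x : UnitAddTorus (Fin 3)) (v : EuclideanSpace ℝ (Fin 3)),
      Torus.fderiv U x v = a • Torus.fderiv Φ x v + b • Torus.fderiv Ψ x v := by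
    intro x v
    have hc0 : Torus.fderiv (fun _ : UnitAddTorus (Fin 3) => c) x = 0 := fderiv_const_apply c
    rw [hUfun, Torus.fderiv_add (isContDiff_const c) ((hΦ1.smul a).add (hΨ1.smul b)),
      Torus.fderiv_add (hΦ1.smul a) (hΨ1.smul b), Torus.fderiv_const_smul hΦ1,
      Torus.fderiv_const_smul hΨ1, hc0, zero_add]
    rfl
  have hconvU : ∀ x, convect (fun y => u t y - U y) U x =
      a • convect (fun y => u t y - U y) Φ x + b • convect (fun y => u t y - U y) Ψ x :=
    fun x => hfd x _
  have hIΦ : Integrable (fun x => ⟪u t x - U x, convect (fun y => u t y - U y) Φ x⟫) volume :=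
    (hw.inner (hw.convect hΦ)).integrable
  have hIΨ : Integrable (fun x => ⟪u t x - U x, convect (fun y => u t y - U y) Ψ x⟫) volume :=
    (hw.inner (hw.convect hΨ)).integrable
  have hsplit : ∫ x, ⟪u t x - U x, convect (fun y => u t y - U y) U x⟫ =
      a * (∫ x, ⟪u t x - U x, convect (fun y => u t y - U y) Φ x⟫) +
        b * (∫ x, ⟪u t x - U x, convect (fun y => u t y - U y) Ψ x⟫) := by
    simp_rw [hconvU, inner_add_right, real_inner_smul_right]
    rw [integral_add (hIΦ.const_mul a) (hIΨ.const_mul b), integral_const_mul, integral_const_mul]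
  -- the transport bounds `|∫⟪w',(w'·∇)Φ⟫|, |∫⟪w',(w'·∇)Ψ⟫| ≤ K ∫‖w'‖²`
  have hTΦ : |∫ x, ⟪u t x - U x, convect (fun y => u t y - U y) Φ x⟫| ≤
      K * ∫ x, ‖u t x - U x‖ ^ 2 :=
    PatternTransport.abs_integral_inner_self_convect_le hΦ1 hKΦ hw
  have hTΨ : |∫ x, ⟪u t x - U x, convect (fun y => u t y - U y) Ψ x⟫| ≤
      K * ∫ x, ‖u t x - U x‖ ^ 2 :=
    PatternTransport.abs_integral_inner_self_convect_le hΨ1 hKΨ hw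
  -- Poincaré for the mean-zero perturbation
  have hP : 4 * Real.pi ^ 2 * ∫ x, ‖u t x - U x‖ ^ 2 ≤ gradNormSq (fun x => u t x - U x) :=
    four_pi_sq_mul_integral_norm_sq_le_gradNormSq hw h0
  have hE2 : ∫ x, ‖u t x - U x‖ ^ 2 = 2 * kineticEnergy (fun x => u t x - U x) := by
    simp only [kineticEnergy]
    ring
  have hX0 : 0 ≤ ∫ x, ‖u t x - U x‖ ^ 2 := integral_nonneg fun _ => sq_nonneg _
  have i1 : -(a * ∫ x, ⟪u t x - U x, convect (fun y => u t y - U y) Φ x⟫) ≤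
      |a| * (K * ∫ x, ‖u t x - U x‖ ^ 2) := by
    have h := neg_le_abs (a * ∫ x, ⟪u t x - U x, convect (fun y => u t y - U y) Φ x⟫)
    rw [abs_mul] at h
    exact h.trans (mul_le_mul_of_nonneg_left hTΦ (abs_nonneg a))
  have i2 : -(b * ∫ x, ⟪u t x - U x, convect (fun y => u t y - U y) Ψ x⟫) ≤
      |b| * (K * ∫ x, ‖u t x - U x‖ ^ 2) := by
    have h := neg_le_abs (b * ∫ x, ⟪u t x - U x, convect (fun y => u t y - U y) Ψ x⟫)
    rw [abs_mul] at h
    exact h.trans (mul_le_mul_of_nonneg_left hTΨ (abs_nonneg b))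
  have i3 : ν * (4 * Real.pi ^ 2 * ∫ x, ‖u t x - U x‖ ^ 2) ≤
      ν * gradNormSq (fun x => u t x - U x) := mul_le_mul_of_nonneg_left hP hν
  have i4 := mul_le_mul_of_nonneg_right hrate hX0
  have i5 : c₀ * ∫ x, ‖u t x - U x‖ ^ 2 = c₀ * (2 * kineticEnergy (fun x => u t x - U x)) := by
    rw [hE2]
  rw [hsplit]
  linarith [i1, i2, i3, i4, i5]

/-- **Exponential decay of the perturbation energy above the threshold.** Under the hypotheses of
`flux_le` (steady state `U = c + aΦ + bΨ` of `NS_ν(f)` with pattern bounds `K`, rate condition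
`2(|a|+|b|)K + c₀ ≤ 8π²ν`), if moreover the force has zero mean and `(u, p)` is a classical
solution on a convex time set `S ⊇ [t₀, t]` with `∫ u(t₀) = ∫ U`, then
`½‖u(t) − U‖₂² ≤ ½‖u(t₀) − U‖₂² · e^{−c₀(t−t₀)}`: the mean of `u` is conserved
(`Torus.IsClassicalNSSolutionOn.integral_velocity_eq`), so `u(s) − U` is mean-zero on `S`; the
perturbation energy has Serrin's flux as one-sided derivative within `S`
(`stub_perturbationEnergyBalance`), bounded by `−c₀E'` (`flux_le`), and Grönwall's inequality
(`le_gronwallBound_of_liminf_deriv_right_le`, `K = −c₀`, `ε = 0`) integrates it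
(Serrin 1959, §2). [folklore] -/
theorem decay (hν : 0 ≤ ν) (hΦ : IsSmooth Φ) (hΨ : IsSmooth Ψ)
    (hKΦ : ∀ x, ∑ i, ‖partialDeriv i Φ x‖ ≤ K) (hKΨ : ∀ x, ∑ i, ‖partialDeriv i Ψ x‖ ≤ K)
    (hUeq : ∀ x, U x = c + (a • Φ x + b • Ψ x))
    (hU : IsClassicalNSSolutionOn univ ν (fun _ => f) (fun _ => U) (fun _ => q))
    (hf : HasZeroMean f) (hu : IsClassicalNSSolutionOn S ν (fun _ => f) u p) {t₀ t : ℝ}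
    (ht : t₀ ≤ t) (hS : Convex ℝ S) (hI : Icc t₀ t ⊆ S) (hu0 : ∫ x, u t₀ x = ∫ x, U x)
    (hrate : 2 * ((|a| + |b|) * K) + c₀ ≤ 8 * Real.pi ^ 2 * ν) :
    kineticEnergy (fun x => u t x - U x) ≤
      kineticEnergy (fun x => u t₀ x - U x) * Real.exp (-(c₀ * (t - t₀))) := by
  have ht₀ : t₀ ∈ S := hI (left_mem_Icc.2 ht)
  have hUs : IsSmooth U := hU.smooth_velocity.isSmooth_slice (mem_univ t₀)
  -- the perturbation is mean-zero on `S` (momentum conservation)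
  have hmean : ∀ s ∈ S, HasZeroMean (fun x => u s x - U x) := by
    intro s hs
    show ∫ x, (u s x - U x) = 0
    rw [integral_sub (hu.smooth_velocity.isSmooth_slice hs).integrable hUs.integrable,
      hu.integral_velocity_eq hS (fun _ _ => hf) ht₀ hs, hu0, sub_self]
  -- Serrin's identity: the flux is the one-sided derivative of the perturbation energy
  have hderiv := stub_perturbationEnergyBalance ν S f U q u p hS hU hu
  have hEc : ContinuousOn (fun s => kineticEnergy (fun x => u s x - U x)) (Icc t₀ t) :=
    fun s hs => ((hderiv s (hI hs)).continuousWithinAt).mono hI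
  have hder : ∀ s ∈ Ico t₀ t, HasDerivWithinAt (fun s => kineticEnergy (fun x => u s x - U x))
      (-(ν * gradNormSq (fun x => u s x - U x)) -
        ∫ x, ⟪u s x - U x, convect (fun y => u s y - U y) U x⟫) (Ici s) s := fun s hs =>
    ((hderiv s (hI (Ico_subset_Icc_self hs))).mono
      ((Icc_subset_Icc hs.1 le_rfl).trans hI)).mono_of_mem_nhdsWithin (Icc_mem_nhdsGE hs.2)
  have hgr := le_gronwallBound_of_liminf_deriv_right_le
    (f := fun s => kineticEnergy (fun x => u s x - U x))
    (f' := fun s => -(ν * gradNormSq (fun x => u s x - U x)) -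
        ∫ x, ⟪u s x - U x, convect (fun y => u s y - U y) U x⟫)
    (δ := kineticEnergy (fun x => u t₀ x - U x)) (K := -c₀) (ε := 0) (a := t₀) (b := t) hEc
    (fun s hs r hr => (hder s hs).liminf_right_slope_le hr) le_rfl
    (fun s hs => (add_zero (-c₀ * kineticEnergy (fun x => u s x - U x))).symm ▸
      flux_le hν hΦ hΨ hKΦ hKΨ hUeq hU hu (hI (Ico_subset_Icc_self hs))
        (hmean s (hI (Ico_subset_Icc_self hs))) hrate) t (right_mem_Icc.2 ht)
  rw [gronwallBound_ε0, neg_mul] at hgr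
  exact hgr

/-- **The laminar amplitudes above `ν = 1`.** For `F, V, ω ≥ 0`, `κ > 0` (here `κ` stands for
`κ²`, `ω` for `2πn`) and `ν ≥ 1`, the amplitudes `a = Fνκ/D`, `b = FVω/D`, `D = V²ω² + ν²κ²`,
satisfy `|a| + |b| ≤ F/κ + FVω/κ²` (`D ≥ ν²κ² ≥ νκ², κ²`). [folklore] -/
theorem coeff_bound {F V ν κ ω : ℝ} (hF : 0 ≤ F) (hV : 0 ≤ V) (hω : 0 ≤ ω) (hκ : 0 < κ)
    (hν : 1 ≤ ν) :
    |F * ν * κ / (V ^ 2 * ω ^ 2 + ν ^ 2 * κ ^ 2)| + |F * V * ω / (V ^ 2 * ω ^ 2 + ν ^ 2 * κ ^ 2)| ≤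
      F / κ + F * V * ω / κ ^ 2 := by
  have hν0 : 0 < ν := one_pos.trans_le hν
  have hD : 0 < V ^ 2 * ω ^ 2 + ν ^ 2 * κ ^ 2 := by positivity
  rw [abs_of_nonneg (by positivity), abs_of_nonneg (by positivity)]
  refine add_le_add ?_ ?_
  · rw [div_le_div_iff₀ hD hκ]
    have h1 : 0 ≤ F * (V ^ 2 * ω ^ 2) := by positivity
    have h2 : 0 ≤ F * κ ^ 2 * (ν * (ν - 1)) := by
      have := sub_nonneg.2 hν
      positivity
    nlinarith [h1, h2]
  · rw [div_le_div_iff₀ hD (by positivity)]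
    have h3 : 0 ≤ F * V * ω * (V ^ 2 * ω ^ 2) := by positivity
    have h4 : 0 ≤ F * V * ω * κ ^ 2 * (ν ^ 2 - 1) := by
      have : 0 ≤ ν ^ 2 - 1 := by nlinarith
      positivity
    nlinarith [h3, h4]

end EnergyStabilityThreshold

/-- **The energy-stability threshold** (registered stub `stub_energyStabilityThreshold` of the line
`Sketch` for the crux `DopplerClock.QuadratureStressFloor`, stmt-AnomalousDissipation-18129). For
every design `(F, V, m, n)` there are `ν_E, c > 0` such that for `ν ≥ ν_E` EVERY classical
drift-`V` solution of `NS_ν(f)`, `f = F sin(2πm x₁) cos(2πn x₂) e₀`, on a convex time set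
`S ⊇ [t₀, t]` relaminarises exponentially in energy towards the laminar streak array
`u_L(ν) = V e₂ + sin(2πm x₁)(a cos 2πn x₂ + b sin 2πn x₂) e₀`:
`½‖u(t) − u_L‖₂² ≤ ½‖u(t₀) − u_L‖₂² · e^{−c(t−t₀)}`. Here `c = 4π²` and
`ν_E = 1 + 2π(m+n)(F/κ² + FV(2πn)/κ⁴)/(4π²)` (`EnergyStabilityThreshold.decay` with `U = u_L`
from `dopplerClock_laminarStreaks_proof`, the pattern bounds of `PatternTransport`, the zero mean
of the force `dopplerClock_forceAdmissible_proof`, and `EnergyStabilityThreshold.coeff_bound`).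
DESIGN RULE: witnesses of the core live at `ν < ν_E` (Serrin 1959; Marchioro 1986). [folklore] -/
theorem stub_energyStabilityThreshold :
    ∀ (F V : ℝ) (m n : ℕ), 0 < F → 0 < V → 0 < m → 0 < n →
      ∃ νE c : ℝ, 0 < νE ∧ 0 < c ∧ ∀ (ν a b : ℝ) (uL : UnitAddTorus (Fin 3) → EuclideanSpace ℝ (Fin 3)), νE ≤ ν →
        a = F * ν * ((2 * Real.pi) ^ 2 * ((m : ℝ) ^ 2 + (n : ℝ) ^ 2)) / (V ^ 2 * (2 * Real.pi * n) ^ 2 + ν ^ 2 * ((2 * Real.pi) ^ 2 * ((m : ℝ) ^ 2 + (n : ℝ) ^ 2)) ^ 2) →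
        b = F * V * (2 * Real.pi * n) / (V ^ 2 * (2 * Real.pi * n) ^ 2 + ν ^ 2 * ((2 * Real.pi) ^ 2 * ((m : ℝ) ^ 2 + (n : ℝ) ^ 2)) ^ 2) →
        uL = (fun (x : UnitAddTorus (Fin 3)) => V • EuclideanSpace.single (2 : Fin 3) (1 : ℝ) +
              ((UnitAddTorus.mFourier (Pi.single (1 : Fin 3) (m : ℤ)) x).im *
                (a * (UnitAddTorus.mFourier (Pi.single (2 : Fin 3) (n : ℤ)) x).re +
                  b * (UnitAddTorus.mFourier (Pi.single (2 : Fin 3) (n : ℤ)) x).im)) •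
                EuclideanSpace.single (0 : Fin 3) (1 : ℝ)) →
        ∀ (S : Set ℝ) (t₀ t : ℝ) (u : ℝ → UnitAddTorus (Fin 3) → EuclideanSpace ℝ (Fin 3))
          (p : ℝ → UnitAddTorus (Fin 3) → ℝ), t₀ ≤ t → Convex ℝ S → Set.Icc t₀ t ⊆ S →
          Literature.Analysis.FunctionSpaces.Torus.IsClassicalNSSolutionOn S ν (fun _ => (fun (x : UnitAddTorus (Fin 3)) => (F * (UnitAddTorus.mFourier (Pi.single (1 : Fin 3) (m : ℤ)) x).im * (UnitAddTorus.mFourier (Pi.single (2 : Fin 3) (n : ℤ)) x).re) • EuclideanSpace.single (0 : Fin 3) (1 : ℝ))) u p →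
          (∫ x, u t₀ x = V • EuclideanSpace.single (2 : Fin 3) (1 : ℝ)) →
          Literature.Analysis.FunctionSpaces.Torus.kineticEnergy (fun x => u t x - uL x) ≤
            Literature.Analysis.FunctionSpaces.Torus.kineticEnergy (fun x => u t₀ x - uL x) *
              Real.exp (-(c * (t - t₀))) := by
  intro F V m n hF hV _hm hn
  -- `L = 2π(m+n)(F/κ² + FV(2πn)/κ⁴)` bounds `2π(m+n)(|a|+|b|)` for `ν ≥ 1`
  set L : ℝ := 2 * Real.pi * ((m : ℝ) + (n : ℝ)) *
    (F / ((2 * Real.pi) ^ 2 * ((m : ℝ) ^ 2 + (n : ℝ) ^ 2)) +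
      F * V * (2 * Real.pi * n) / ((2 * Real.pi) ^ 2 * ((m : ℝ) ^ 2 + (n : ℝ) ^ 2)) ^ 2) with hL
  have hL0 : 0 ≤ L := by positivity
  have hπ : 0 < 4 * Real.pi ^ 2 := by positivity
  refine ⟨1 + L / (4 * Real.pi ^ 2), 4 * Real.pi ^ 2, by positivity, hπ,
    fun ν a b uL hνE ha hb huL S t₀ t u p ht hS hI hu hu0 => ?_⟩
  have hν1 : 1 ≤ ν := (le_add_of_nonneg_right (by positivity)).trans hνE
  have hν : 0 < ν := one_pos.trans_le hν1
  subst huL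
  -- the laminar streak array: steady classical solution with zero pressure and momentum `V e₂`
  obtain ⟨hLam, hLi, -⟩ := dopplerClock_laminarStreaks_proof F V ν m n hV hν hn
  rw [← ha, ← hb] at hLam hLi
  -- the rate condition `2·2π(m+n)(|a|+|b|) + 4π² ≤ 8π²ν`
  have hab : |a| + |b| ≤ F / ((2 * Real.pi) ^ 2 * ((m : ℝ) ^ 2 + (n : ℝ) ^ 2)) +
      F * V * (2 * Real.pi * n) / ((2 * Real.pi) ^ 2 * ((m : ℝ) ^ 2 + (n : ℝ) ^ 2)) ^ 2 := by
    rw [ha, hb]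
    exact EnergyStabilityThreshold.coeff_bound hF.le hV.le (by positivity) (by positivity) hν1
  have h1 : 2 * Real.pi * ((m : ℝ) + (n : ℝ)) * (|a| + |b|) ≤ L :=
    mul_le_mul_of_nonneg_left hab (by positivity)
  have h2 : 4 * Real.pi ^ 2 * (1 + L / (4 * Real.pi ^ 2)) ≤ 4 * Real.pi ^ 2 * ν :=
    mul_le_mul_of_nonneg_left hνE hπ.le
  have h3 : 4 * Real.pi ^ 2 * (1 + L / (4 * Real.pi ^ 2)) = 4 * Real.pi ^ 2 + L := by
    rw [mul_add, mul_one, mul_div_cancel₀ _ hπ.ne']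
  have hrate : 2 * ((|a| + |b|) * (2 * Real.pi * ((m : ℝ) + (n : ℝ)))) + 4 * Real.pi ^ 2 ≤
      8 * Real.pi ^ 2 * ν := by
    linarith [h1, h2, h3]
  exact EnergyStabilityThreshold.decay (K := 2 * Real.pi * ((m : ℝ) + (n : ℝ)))
    (c := V • EuclideanSpace.single (2 : Fin 3) (1 : ℝ)) hν.le
    (DopplerStreaks.sinCos_regular m n).1 (DopplerWork.pattern_regular m n).1
    (PatternTransport.sum_norm_partialDeriv_copattern_le m n)
    (PatternTransport.sum_norm_partialDeriv_pattern_le m n)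
    (fun x => by
      simp only [smul_smul, ← add_smul]
      congr 2
      ring)
    hLam (dopplerClock_forceAdmissible_proof F m n).2.2 hu ht hS hI (hu0.trans hLi.symm) hrate

end Summit.AnomalousDissipation.AnomalousDissipation.Theorems

end
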